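import Summits.NavierStokesRegularity.NavierStokesRegularity.Theses.AxisymmetricExtremality
import Summits.NavierStokesRegularity.NavierStokesRegularity.Theorems.AxisymmetricExtremalityAxisymmetricKatoGlobalNoSwirlStratum
import Literature.Analysis.FluidPDE.AxisymmetricReflection
import Literature.Analysis.FluidPDE.RusinSverakSingularPoint
import Literature.Analysis.FluidPDE.SuitableWeak
import HarnessLib.Audit

/-!
# Strategist census s15-g2 — checked sketch for crux `AxisymmetricKatoGlobal`
(item `stmt-NavierStokesRegularity-15453`, route `AxisymmetricExtremality`)

This file backs `STRATEGY-CENSUS-s15-g2.md`.  It contains NO new line and NO stubs: only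
(A) the two "weaker intermediate" statements the census discusses, with the provable directions
proved (no `sorry`), and (B) the typed signatures used under the Decomposition / Strengthen
headings, as bare `def … : Prop` so that the census can point at elaborated statements.

* `NoAxisymMinimalBlowup` — W1, the threshold instance that `closes` actually consumes;
  `noAxisymMinimalBlowup_of_crux` is the trivial direction.
* `no_O2_minimalBlowup` — W2, PROVABLE NOW from tree theorems: an axisymmetric minimal blow-up
  datum that is also fixed by conjugation with the meridian reflection `reflY` has no swirl
  (`IsAxisymmetric.hasNoSwirl_of_conj_reflY_eq`), hence a global Kato solution
  (`axisymmetricKatoGlobal_noSwirl_stratum`), contradicting minimality.  Consequence recorded in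
  the census: any extremality lever that delivers O(2)- (dihedral-for-all-p-) symmetric minimal data
  makes this crux REDUNDANT; the crux is load-bearing exactly for CHIRAL axisymmetric data.
* `DihedralToO2` / `no_dihedral_minimal_sequence` — the dihedral analogue of the landed
  `PFoldToAxisymmetric`, and the AX-free contradiction it would give.
* `SwirlEpsRegularity`, `SwirlSmallAtAxis`, `CriticalAxisVelocityBound` — signatures for the
  census's Decomposition (D3) and Strengthen (S⁺) attempts.
-/

noncomputable section

open MeasureTheory Set Metric Filter Topology
open scoped ENNReal
open Literature.Analysis.FluidPDE Literature.Analysis.FunctionSpaces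

namespace Summit.NavierStokesRegularity.NavierStokesRegularity.Cruxes.AxisymmetricKatoGlobal.StrategistS15g2

local notation "ℝ³" => EuclideanSpace ℝ (Fin 3)
local notation "ℂ³" => EuclideanSpace ℂ (Fin 3)

/-! ## (A) Weaker intermediates -/

/-- **W1 — the threshold instance.** No axisymmetric `Ḣ^{1/2}`-minimal blow-up datum, for any
viscosity.  This is exactly what the route's `closes` consumes from `AxisymmetricKatoGlobal`. -/
def NoAxisymMinimalBlowup : Prop :=
  ∀ ν : ℝ, 0 < ν → ∀ (u₀ : ℝ³ → ℝ³) (g : HomSobolev ℝ³ ℂ³ (1 / 2 : ℝ)),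
    IsMinimalBlowupDatum ν u₀ g → IsAxisymmetric u₀ → False

/-- crux ⇒ W1 (the only direction that is formal). -/
theorem noAxisymMinimalBlowup_of_crux
    (h : Theses.AxisymmetricExtremality.AxisymmetricKatoGlobal) : NoAxisymMinimalBlowup := by
  intro ν hν u₀ g hmin hax
  obtain ⟨h3, hrep, hdiv, _, hnot⟩ := hmin
  exact hnot (h ν hν u₀ g h3 hrep hdiv (fun θ x => hax θ x))

/-- **W2 — no O(2)-symmetric minimal blow-up datum (provable now).**  An axisymmetric minimal
blow-up datum fixed by conjugation with the meridian reflection `σ = reflY` is swirl-free, hence has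
a global Kato solution by the landed swirl-free stratum — contradiction with minimality. -/
theorem no_O2_minimalBlowup (ν : ℝ) (hν : 0 < ν) (u₀ : ℝ³ → ℝ³)
    (g : HomSobolev ℝ³ ℂ³ (1 / 2 : ℝ)) (hmin : IsMinimalBlowupDatum ν u₀ g)
    (hax : IsAxisymmetric u₀) (hrefl : ∀ x, reflY (u₀ (reflY.symm x)) = u₀ x) : False := by
  obtain ⟨h3, _, hdiv, _, hnot⟩ := hmin
  exact hnot
    (Theorems.AxisymmetricKatoGlobal.NoSwirlStratum.axisymmetricKatoGlobal_noSwirl_stratum ν hν u₀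
      h3 hdiv (fun θ x => hax θ x) (hax.hasNoSwirl_of_conj_reflY_eq hrefl))

/-- W2 as a `Prop`. -/
def NoO2MinimalBlowup : Prop :=
  ∀ ν : ℝ, 0 < ν → ∀ (u₀ : ℝ³ → ℝ³) (g : HomSobolev ℝ³ ℂ³ (1 / 2 : ℝ)),
    IsMinimalBlowupDatum ν u₀ g → IsAxisymmetric u₀ →
      (∀ x, reflY (u₀ (reflY.symm x)) = u₀ x) → False

theorem noO2MinimalBlowup_holds : NoO2MinimalBlowup :=
  fun ν hν u₀ g hmin hax hrefl => no_O2_minimalBlowup ν hν u₀ g hmin hax hrefl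

/-- **Dihedral compactness upgrade** (statement only; the method is the landed proof of
`PFoldToAxisymmetric`, run with one more closed condition): minimal blow-up data equivariant under
`R_{2π/p}` AND fixed by `reflY`-conjugation for unboundedly many `p` yield an O(2)-symmetric
minimal blow-up datum. -/
def DihedralToO2 : Prop :=
  ∀ ν : ℝ, 0 < ν →
    (∀ N : ℕ, ∃ p : ℕ, N ≤ p ∧ 2 ≤ p ∧ ∃ (u₀ : ℝ³ → ℝ³) (g : HomSobolev ℝ³ ℂ³ (1 / 2 : ℝ)),
        IsMinimalBlowupDatum ν u₀ g ∧
          (∀ x, u₀ (rotZ (2 * Real.pi / p) x) = rotZ (2 * Real.pi / p) (u₀ x)) ∧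
          (∀ x, reflY (u₀ (reflY.symm x)) = u₀ x)) →
    ∃ (u₀ : ℝ³ → ℝ³) (g : HomSobolev ℝ³ ℂ³ (1 / 2 : ℝ)),
      IsMinimalBlowupDatum ν u₀ g ∧ IsAxisymmetric u₀ ∧ (∀ x, reflY (u₀ (reflY.symm x)) = u₀ x)

/-- Under `DihedralToO2`, dihedrally symmetric minimal blow-up data for unboundedly many `p` cannot
exist — WITHOUT the crux `AxisymmetricKatoGlobal`. -/
theorem no_dihedral_minimal_sequence (hD : DihedralToO2) (ν : ℝ) (hν : 0 < ν)
    (hseq : ∀ N : ℕ, ∃ p : ℕ, N ≤ p ∧ 2 ≤ p ∧ ∃ (u₀ : ℝ³ → ℝ³) (g : HomSobolev ℝ³ ℂ³ (1 / 2 : ℝ)),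
        IsMinimalBlowupDatum ν u₀ g ∧
          (∀ x, u₀ (rotZ (2 * Real.pi / p) x) = rotZ (2 * Real.pi / p) (u₀ x)) ∧
          (∀ x, reflY (u₀ (reflY.symm x)) = u₀ x)) : False := by
  obtain ⟨u₀, g, hmin, hax, hrefl⟩ := hD ν hν hseq
  exact no_O2_minimalBlowup ν hν u₀ g hmin hax hrefl

/-! ## (B) Signatures used under Decomposition / Strengthen (statements only) -/

/-- **D3a — absolute small-swirl ε-regularity at an axis point** (the log-free version of the
Lei–Zhang / Wei criteria; OPEN, strictly smaller than the crux).  If the swirl `Γ = r u_θ` is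
`ε₀`-small on a backward parabolic neighbourhood of an axis point `(T, x₀)`, then the scaled cubic
quantity stays bounded there (no concentration). -/
def SwirlEpsRegularity : Prop :=
  ∃ ε₀ : ℝ, 0 < ε₀ ∧ ∀ ν : ℝ, 0 < ν → ∀ T : ℝ, 0 < T → ∀ (u₀ : ℝ³ → ℝ³) (u : ℝ → ℝ³ → ℝ³),
    IsKatoSolutionOn T ν u₀ u → ContDiffOn ℝ (⊤ : ℕ∞) (Function.uncurry u) (Ioo 0 T ×ˢ univ) →
    (∀ t ∈ Ioo 0 T, IsAxisymmetric (u t)) →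
    ∀ x₀ : ℝ³, cylRadius x₀ = 0 →
      (∃ r₀ : ℝ, 0 < r₀ ∧ ∀ t ∈ Ioo (T - r₀ ^ 2) T, ∀ x ∈ ball x₀ r₀, |swirl (u t) x| ≤ ε₀ * ν) →
      limsup (fun r => cknC r ((T, x₀) : ℝ × ℝ³) u) (𝓝[>] 0) < ∞

/-- **D3b — a priori smallness of the swirl at the axis up to the final time** (implied by the
crux; no mechanism known: `Γ` is only bounded, by the maximum principle). -/
def SwirlSmallAtAxis : Prop :=
  ∀ ε : ℝ, 0 < ε → ∀ ν : ℝ, 0 < ν → ∀ T : ℝ, 0 < T → ∀ (u₀ : ℝ³ → ℝ³)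
    (g : HomSobolev ℝ³ ℂ³ (1 / 2 : ℝ)) (u : ℝ → ℝ³ → ℝ³),
    g.Represents (Literature.Analysis.FunctionSpaces.EuclideanSpace.complexify ∘ u₀) →
    IsKatoSolutionOn T ν u₀ u → ContDiffOn ℝ (⊤ : ℕ∞) (Function.uncurry u) (Ioo 0 T ×ˢ univ) →
    (∀ t ∈ Ioo 0 T, IsAxisymmetric (u t)) →
    ∀ x₀ : ℝ³, cylRadius x₀ = 0 →
      ∃ r₀ : ℝ, 0 < r₀ ∧ ∀ t ∈ Ioo (T - r₀ ^ 2) T, ∀ x ∈ ball x₀ r₀, |swirl (u t) x| ≤ ε * ν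

/-- **S⁺ — the scale-critical a priori velocity bound at the axis** (`r |u| ≤ C` up to the final
time; KNSS 2009 Thm 5.3 / 6.x then give regularity).  Known a priori: `r² |u| ≤ C √|ln r|`
(Lei–Navas–Zhang 2016) — one power of `r` short. -/
def CriticalAxisVelocityBound : Prop :=
  ∀ ν : ℝ, 0 < ν → ∀ T : ℝ, 0 < T → ∀ (u₀ : ℝ³ → ℝ³)
    (g : HomSobolev ℝ³ ℂ³ (1 / 2 : ℝ)) (u : ℝ → ℝ³ → ℝ³),
    g.Represents (Literature.Analysis.FunctionSpaces.EuclideanSpace.complexify ∘ u₀) →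
    IsKatoSolutionOn T ν u₀ u → ContDiffOn ℝ (⊤ : ℕ∞) (Function.uncurry u) (Ioo 0 T ×ˢ univ) →
    (∀ t ∈ Ioo 0 T, IsAxisymmetric (u t)) →
    ∀ t₀ ∈ Ioo 0 T, ∃ C δ₀ : ℝ, 0 < δ₀ ∧
      ∀ t ∈ Ico t₀ T, ∀ x : ℝ³, cylRadius x ≤ δ₀ → cylRadius x * ‖u t x‖ ≤ C

end Summit.NavierStokesRegularity.NavierStokesRegularity.Cruxes.AxisymmetricKatoGlobal.StrategistS15g2

end
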